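import Summits.Ventures.Crystal3D.Theorems.StickyWulffConstantPolycrystalWulffBoundTwinSectionShiftHolds
import Literature.MathematicalPhysics.StatisticalMechanics.BarlowTexturedSet

/-!
# The mirror orthogonal to a nearest-neighbour bond is a symmetry of the grain's lattice
# (`PolycrystalWulffBound`, line `PolyDensity`, crux `stmt-Ventures-19482`)

Route `StickyWulffConstant` of the venture `Summits/Ventures/Crystal3D`, second prover lane (poly-p2,
gen 10).  The single-axis rungs (`rung_zone`, `rung_singleAxis_cells`, `rung_singleAxis_texture(_of_charge)`)
take a horizontal bond `u ∈ A '' Λ₀` AND the mirror hypothesis `R_u '' (A '' Λ₀) = A '' Λ₀`.  The second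
follows from the first: for every frame `A` and every unit vector `u ∈ A '' Λ₀`,
`(ℝ ∙ u)ᗮ.reflection '' (A '' Λ₀) = A '' Λ₀` (`reflection_image_lattice_eq_of_bond`).  Proof: `Λ₀` is
the additive group generated by its unit shell (`fccHost_eq_closure_barlowShell`); the shell is a cubic
image of the integer pattern `{(±1,±1,0),…}/√2`, so `2⟪u₀, v⟫ ∈ ℤ` for shell vectors `u₀, v` and
`R_{u₀} v = v − 2⟪u₀,v⟫ u₀ ∈ Λ₀`; hence `R_{u₀}` maps the shell into the shell, onto by involutivity,
and the generated groups agree.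
WHAT THIS IS NOT: anything about energies; the crux is not claimed.
-/

noncomputable section

open scoped BigOperators InnerProductSpace
open Set

namespace Summit.Ventures.Crystal3D.Theorems

open Summit.Ventures.Crystal3D.Cruxes.TextureLiminf.TexShadow (E3)
open Literature.MathematicalPhysics.StatisticalMechanics (fccStacking fccHost barlowShell
  fccHost_eq_closure_barlowShell image_fccHost_eq_closure barlowShell_one_neg_one_eq)
open Literature.Geometry.DiscreteGeometry (fccKissingPattern fccInt scaledPattern intVec intVec_apply)

/-- Inner products of vectors of the fcc kissing pattern are half-integers: `2⟪p, q⟫ ∈ ℤ`. -/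
theorem two_inner_fccKissingPattern_int {p q : E3} (hp : p ∈ (fccKissingPattern : Set E3))
    (hq : q ∈ (fccKissingPattern : Set E3)) : ∃ n : ℤ, 2 * ⟪p, q⟫_ℝ = n := by
  rw [Finset.mem_coe, fccKissingPattern, scaledPattern, Finset.mem_image] at hp hq
  obtain ⟨s, -, rfl⟩ := hp
  obtain ⟨t, -, rfl⟩ := hq
  refine ⟨∑ i, s i * t i, ?_⟩
  have h2 : Real.sqrt ((2 : ℕ) : ℝ) ^ 2 = 2 := Real.sq_sqrt (by norm_num)
  rw [real_inner_smul_left, real_inner_smul_right]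
  have hin : ⟪intVec s, intVec t⟫_ℝ = ∑ i, (s i : ℝ) * t i := by
    simp [PiLp.inner_apply, intVec_apply, mul_comm]
  rw [hin]
  push_cast
  have hs2 : (Real.sqrt ((2 : ℕ) : ℝ))⁻¹ * (Real.sqrt ((2 : ℕ) : ℝ))⁻¹ = 1 / 2 := by
    rw [← mul_inv, ← sq, h2]; norm_num
  calc (2 : ℝ) * ((Real.sqrt ((2 : ℕ) : ℝ))⁻¹ * ((Real.sqrt ((2 : ℕ) : ℝ))⁻¹ * ∑ i, (s i : ℝ) * t i))
      = 2 * ((Real.sqrt ((2 : ℕ) : ℝ))⁻¹ * (Real.sqrt ((2 : ℕ) : ℝ))⁻¹) * ∑ i, (s i : ℝ) * t i := by ring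
    _ = ∑ i, (s i : ℝ) * t i := by rw [hs2]; ring

/-- For unit shell vectors `u₀, v` of `Λ₀`: `2⟪u₀, v⟫ ∈ ℤ`. -/
theorem two_inner_shell_int {u₀ v : E3}
    (hu : u₀ ∈ {w : E3 | w ∈ fccStacking 1 (Real.sqrt (2 / 3)) ∧ ‖w‖ = 1})
    (hv : v ∈ {w : E3 | w ∈ fccStacking 1 (Real.sqrt (2 / 3)) ∧ ‖w‖ = 1}) :
    ∃ n : ℤ, 2 * ⟪u₀, v⟫_ℝ = n := by
  obtain ⟨L, hL, -⟩ := exists_cubicFrame_unitShell_eq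
  rw [hL] at hu hv
  obtain ⟨p, hp, rfl⟩ := hu
  obtain ⟨q, hq, rfl⟩ := hv
  rw [LinearIsometryEquiv.inner_map_map]
  exact two_inner_fccKissingPattern_int hp hq

/-- The mirror orthogonal to a unit shell vector maps the unit shell of `Λ₀` into itself. -/
theorem reflection_shell_subset {u₀ : E3}
    (hu : u₀ ∈ {w : E3 | w ∈ fccStacking 1 (Real.sqrt (2 / 3)) ∧ ‖w‖ = 1}) :
    (ℝ ∙ u₀)ᗮ.reflection '' {w : E3 | w ∈ fccStacking 1 (Real.sqrt (2 / 3)) ∧ ‖w‖ = 1} ⊆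
      {w : E3 | w ∈ fccStacking 1 (Real.sqrt (2 / 3)) ∧ ‖w‖ = 1} := by
  rintro _ ⟨v, hv, rfl⟩
  refine ⟨?_, by rw [LinearIsometryEquiv.norm_map]; exact hv.2⟩
  obtain ⟨n, hn⟩ := two_inner_shell_int hu hv
  have happ : (ℝ ∙ u₀)ᗮ.reflection v = v - (n : ℝ) • u₀ := by
    rw [reflection_orthogonal_apply_div, hu.2, one_pow, div_one, hn]
  rw [happ]
  -- `Λ₀` is the additive group generated by its shell
  have hΛ : (fccStacking 1 (Real.sqrt (2 / 3)) : Set E3) =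
      (AddSubgroup.closure (barlowShell 1 (-1)) : Set E3) := fccHost_eq_closure_barlowShell
  have hshell : barlowShell 1 (-1) = {v : E3 | v ∈ fccStacking 1 (Real.sqrt (2 / 3)) ∧ ‖v‖ = 1} :=
    barlowShell_one_neg_one_eq
  have hvΛ : v ∈ (AddSubgroup.closure (barlowShell 1 (-1)) : Set E3) :=
    AddSubgroup.subset_closure (by rw [hshell]; exact hv)
  have huΛ : u₀ ∈ (AddSubgroup.closure (barlowShell 1 (-1)) : Set E3) :=
    AddSubgroup.subset_closure (by rw [hshell]; exact hu)
  show v - (n : ℝ) • u₀ ∈ fccStacking 1 (Real.sqrt (2 / 3))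
  rw [hΛ, show (n : ℝ) • u₀ = n • u₀ from (Int.cast_smul_eq_zsmul ℝ n u₀)]
  exact (AddSubgroup.closure (barlowShell 1 (-1))).sub_mem hvΛ
    ((AddSubgroup.closure (barlowShell 1 (-1))).zsmul_mem huΛ n)

/-- The mirror orthogonal to a unit shell vector preserves the unit shell of `Λ₀`. -/
theorem reflection_shell_eq {u₀ : E3}
    (hu : u₀ ∈ {w : E3 | w ∈ fccStacking 1 (Real.sqrt (2 / 3)) ∧ ‖w‖ = 1}) :
    (ℝ ∙ u₀)ᗮ.reflection '' {w : E3 | w ∈ fccStacking 1 (Real.sqrt (2 / 3)) ∧ ‖w‖ = 1} =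
      {w : E3 | w ∈ fccStacking 1 (Real.sqrt (2 / 3)) ∧ ‖w‖ = 1} := by
  refine subset_antisymm (reflection_shell_subset hu) ?_
  intro v hv
  refine ⟨(ℝ ∙ u₀)ᗮ.reflection v, reflection_shell_subset hu ⟨v, hv, rfl⟩, ?_⟩
  exact Submodule.reflection_reflection _ v

/-- **The mirror orthogonal to a nearest-neighbour bond is a symmetry of the grain's lattice**:
for a frame `A` and a unit vector `u ∈ A '' Λ₀`, `R_u '' (A '' Λ₀) = A '' Λ₀`. -/
theorem reflection_image_lattice_eq_of_bond (A : E3 ≃ₗᵢ[ℝ] E3) {u : E3}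
    (hu : u ∈ A '' fccStacking 1 (Real.sqrt (2 / 3))) (hu1 : ‖u‖ = 1) :
    (ℝ ∙ u)ᗮ.reflection '' (A '' fccStacking 1 (Real.sqrt (2 / 3))) =
      A '' fccStacking 1 (Real.sqrt (2 / 3)) := by
  obtain ⟨u₀, hu₀, rfl⟩ := hu
  have hu₀1 : ‖u₀‖ = 1 := by rwa [LinearIsometryEquiv.norm_map] at hu1
  rw [reflection_image_image_eq_of_map A u₀]
  congr 1
  -- in the reference lattice: both sides are the groups generated by the (equal) shells
  have h1 : ((ℝ ∙ u₀)ᗮ.reflection : E3 ≃ₗᵢ[ℝ] E3) '' (fccHost : Set E3) =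
      (AddSubgroup.closure (((ℝ ∙ u₀)ᗮ.reflection : E3 ≃ₗᵢ[ℝ] E3) '' barlowShell 1 (-1)) : Set E3) :=
    image_fccHost_eq_closure _
  have hshell : barlowShell 1 (-1) = {v : E3 | v ∈ fccStacking 1 (Real.sqrt (2 / 3)) ∧ ‖v‖ = 1} :=
    barlowShell_one_neg_one_eq
  show ((ℝ ∙ u₀)ᗮ.reflection : E3 ≃ₗᵢ[ℝ] E3) '' (fccHost : Set E3) = fccHost
  rw [h1, hshell, reflection_shell_eq ⟨hu₀, hu₀1⟩, ← hshell]
  exact fccHost_eq_closure_barlowShell.symm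

end Summit.Ventures.Crystal3D.Theorems

end
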